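import Mathlib

/-!
# `TorsionTiling11a1`: the duplication `x`-map of `11a1` as a real change of variables (helper file)

Helper file for item stmt-KontsevichZagierPeriods-4692 (`TorsionTiling11a1`, support of route
HeckeMultiplicityOne of `KontsevichZagierPeriods`); the closing theorem is in
`HeckeMultiplicityOneTorsionTiling11a1.lean`.

For `E = X₀(11) = 11a1`, `y² + y = x³ − x² − 10x − 20`, put `q(x) = (2y+1)² = 4x³ − 4x² − 40x − 79`
and let `φ(x) = N(x)/q(x)`, `N(x) = x⁴ + 20x² + 158x + 21`, be the `x`-coordinate of the
DUPLICATION map `Q ↦ 2Q` (Silverman, *Arithmetic of Elliptic Curves*, III.2.3(d):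
`x(2Q) = (x⁴ − b₄x² − 2b₆x − b₈)/(4x³ + b₂x² + 2b₄x + b₆)` with `b₂ = −4, b₄ = −20, b₆ = −79,
b₈ = −21`). Since `[2]^*ω = 2ω` for `ω = dx/(2y+1)`, the Wronskian `W = N′q − Nq′` satisfies the
polynomial identity `W² = 4·(4N³ − 4N²q − 40Nq² − 79q³)`, i.e. `q(φ(x))·4 = q(x)·φ′(x)²`
(`key_identity`). On the real points `E(ℝ) ≅ ℝ/Ωℤ` the `5`-torsion points `(16, ·)`, `(5, ·)` sit
at `±Ω/5`, `±2Ω/5`; doubling maps the arc over `x ∈ (16, ∞)` (`z ∈ (0, Ω/5)`) onto the arc over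
`x ∈ (5, ∞)` (`z ∈ (0, 2Ω/5)`) and the arc over `x ∈ (e₁, 5)` (`z ∈ (2Ω/5, Ω/2)`, `e₁` the real
`2`-torsion abscissa) onto the arc over `x ∈ (16, ∞)`. This file proves exactly the real algebra
needed to run these two maps as moves of Kontsevich–Zagier's rule (2):

* sign facts for `q` (`q < 0` on `(−∞, 4]`, `q` increasing on `[4, ∞)`), `N > 0`, and for `W`
  (`W > 0` on `(16, ∞)`, `W < 0` on `(4, 5)`), all by explicit polynomial certificates;
* `hasDerivAt_phi` (`φ′ = W/q²`), `five_lt_phi`, `sixteen_lt_phi`, the intermediate-value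
  surjectivity statements, strict (anti-)monotonicity, and the two image computations
  `φ((16, ∞)) = (5, ∞)`, `φ({q > 0} ∩ (−∞, 5)) = (16, ∞)`;
* `jacobian_phi`: `2/√q(x) = |φ′(x)|/√q(φ(x))`.

All functions are written out as hypotheses `hN : ∀ t, N t = …`, `hq : ∀ t, q t = …` (no
definitions are introduced).

References: J. H. Silverman, *The Arithmetic of Elliptic Curves* (2009), III.2.3;
J. E. Cremona, *Algorithms for Modular Elliptic Curves* (1997), Table 1 (curve 11a1);
M. Kontsevich, D. Zagier, *Periods* (2001), §1.2 rule (2).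
-/

noncomputable section

open Set

namespace Summit.KontsevichZagierPeriods.HeckeMultiplicityOne.TorsionTiling11a1

/-! ### Sign facts for `q = 4x³ − 4x² − 40x − 79` and `N = x⁴ + 20x² + 158x + 21` -/

/-- `q < 0` on `(−∞, 4]`: `−q(t) = 4(4 − t)(t + 2)² + 4(t − 1)² + 11`. [folklore] -/
theorem q_neg_of_le_four {t : ℝ} (ht : t ≤ 4) : 4 * t ^ 3 - 4 * t ^ 2 - 40 * t - 79 < 0 := by
  nlinarith [mul_nonneg (sub_nonneg.2 ht) (sq_nonneg (t + 2)), sq_nonneg (t - 1)]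

/-- `q(t) > 0` forces `t > 4`. [folklore] -/
theorem four_lt_of_q_pos {t : ℝ} (h : 0 < 4 * t ^ 3 - 4 * t ^ 2 - 40 * t - 79) : 4 < t := by
  by_contra h'
  exact absurd h (not_lt.2 (q_neg_of_le_four (not_lt.1 h')).le)

/-- `q` is strictly increasing on `[4, ∞)`:
`q(b) − q(a) = (b − a)(4(a² + ab + b²) − 4(a + b) − 40)`. [folklore] -/
theorem q_lt_q {a b : ℝ} (ha : 4 ≤ a) (hab : a < b) :
    4 * a ^ 3 - 4 * a ^ 2 - 40 * a - 79 < 4 * b ^ 3 - 4 * b ^ 2 - 40 * b - 79 := by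
  have hx : 0 ≤ a - 4 := sub_nonneg.2 ha
  have hy : 0 ≤ b - 4 := by linarith
  have hS : 0 < 4 * (a ^ 2 + a * b + b ^ 2) - 4 * (a + b) - 40 := by
    nlinarith [mul_nonneg hx hy, sq_nonneg (a - 4), sq_nonneg (b - 4)]
  nlinarith [mul_pos (sub_pos.2 hab) hS]

/-- `{q > 0}` is an up-set: `q(a) > 0`, `a ≤ b` give `q(b) > 0`. [folklore] -/
theorem q_pos_of_le {a b : ℝ} (ha : 0 < 4 * a ^ 3 - 4 * a ^ 2 - 40 * a - 79) (hab : a ≤ b) :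
    0 < 4 * b ^ 3 - 4 * b ^ 2 - 40 * b - 79 := by
  rcases hab.eq_or_lt with rfl | hlt
  · exact ha
  · exact ha.trans (q_lt_q (four_lt_of_q_pos ha).le hlt)

/-- `q > 0` on `(5, ∞)` (`q(5) = 121`). [folklore] -/
theorem q_pos_of_five_lt {t : ℝ} (ht : 5 < t) : 0 < 4 * t ^ 3 - 4 * t ^ 2 - 40 * t - 79 :=
  q_pos_of_le (a := 5) (by norm_num) ht.le

/-- `N > 0` on `(0, ∞)`. [folklore] -/
theorem N_pos {t : ℝ} (ht : 0 < t) : 0 < t ^ 4 + 20 * t ^ 2 + 158 * t + 21 := by positivity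

/-! ### The Wronskian `W = N′q − Nq′` and the key identity -/

/-- **Key identity** (invariance `[2]^*ω = 2ω` of `ω = dx/√q` under duplication, squared and
cleared of denominators): `W² = 4(4N³ − 4N²q − 40Nq² − 79q³)` with
`W = N′q − Nq′ = 4x⁶ − 8x⁵ − 200x⁴ − 1580x³ − 420x² − 2992x − 11642`.
[cite: SilvermanAEC2009, III.2.3] -/
theorem key_identity (t : ℝ) :
    (4 * t ^ 6 - 8 * t ^ 5 - 200 * t ^ 4 - 1580 * t ^ 3 - 420 * t ^ 2 - 2992 * t - 11642) ^ 2 =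
      4 * (4 * (t ^ 4 + 20 * t ^ 2 + 158 * t + 21) ^ 3
        - 4 * (t ^ 4 + 20 * t ^ 2 + 158 * t + 21) ^ 2 * (4 * t ^ 3 - 4 * t ^ 2 - 40 * t - 79)
        - 40 * (t ^ 4 + 20 * t ^ 2 + 158 * t + 21) * (4 * t ^ 3 - 4 * t ^ 2 - 40 * t - 79) ^ 2
        - 79 * (4 * t ^ 3 - 4 * t ^ 2 - 40 * t - 79) ^ 3) := by
  ring

/-- `W > 0` on `(16, ∞)`: all Taylor coefficients of `W` at `16` are positive. [folklore] -/
theorem W_pos {t : ℝ} (ht : 16 < t) :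
    0 < 4 * t ^ 6 - 8 * t ^ 5 - 200 * t ^ 4 - 1580 * t ^ 3 - 420 * t ^ 2 - 2992 * t - 11642 := by
  have hs : 0 < t - 16 := sub_pos.2 ht
  nlinarith [pow_pos hs 6, pow_pos hs 5, pow_pos hs 4, pow_pos hs 3, pow_pos hs 2, hs]

/-- `W < 0` on `(0, 5)`: `W = −4t⁵(5 − t) − 12t⁴(5 − t) − 140t⁴ − 1580t³ − 420t² − 2992t − 11642`.
[folklore] -/
theorem W_neg {t : ℝ} (h0 : 0 < t) (h5 : t < 5) :
    4 * t ^ 6 - 8 * t ^ 5 - 200 * t ^ 4 - 1580 * t ^ 3 - 420 * t ^ 2 - 2992 * t - 11642 < 0 := by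
  have h5' : 0 < 5 - t := sub_pos.2 h5
  nlinarith [mul_pos (pow_pos h0 5) h5', mul_pos (pow_pos h0 4) h5', pow_pos h0 4, pow_pos h0 3,
    pow_pos h0 2]

/-! ### The duplication `x`-map `φ = N/q` -/

section Phi

variable {N q W : ℝ → ℝ}

/-- `φ = N/q` has derivative `W/q²` off the zeros of `q` (quotient rule). [folklore] -/
theorem hasDerivAt_phi (hN : ∀ t, N t = t ^ 4 + 20 * t ^ 2 + 158 * t + 21)
    (hq : ∀ t, q t = 4 * t ^ 3 - 4 * t ^ 2 - 40 * t - 79)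
    (hW : ∀ t, W t = 4 * t ^ 6 - 8 * t ^ 5 - 200 * t ^ 4 - 1580 * t ^ 3 - 420 * t ^ 2
      - 2992 * t - 11642)
    {t : ℝ} (hqt : q t ≠ 0) : HasDerivAt (fun y => N y / q y) (W t / q t ^ 2) t := by
  have hN' : HasDerivAt N (4 * t ^ 3 + 40 * t + 158) t := by
    have hfun : N = fun y => y ^ 4 + 20 * y ^ 2 + 158 * y + 21 := funext hN
    rw [hfun]
    refine ((((hasDerivAt_pow 4 t).add ((hasDerivAt_pow 2 t).const_mul 20)).add
      ((hasDerivAt_id' t).const_mul 158)).add_const 21).congr_deriv ?_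
    simp
    ring
  have hq' : HasDerivAt q (12 * t ^ 2 - 8 * t - 40) t := by
    have hfun : q = fun y => 4 * y ^ 3 - 4 * y ^ 2 - 40 * y - 79 := funext hq
    rw [hfun]
    refine (((((hasDerivAt_pow 3 t).const_mul 4).sub ((hasDerivAt_pow 2 t).const_mul 4)).sub
      ((hasDerivAt_id' t).const_mul 40)).sub_const 79).congr_deriv ?_
    simp
    ring
  refine (hN'.div hq' hqt).congr_deriv ?_
  rw [hW, hN, hq]
  congr 1
  ring

/-- `φ > 5` on `(16, ∞)`: `N − 5q = (x − 16)(x³ − 4x² − 24x − 26)`. [folklore] -/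
theorem five_lt_phi (hN : ∀ t, N t = t ^ 4 + 20 * t ^ 2 + 158 * t + 21)
    (hq : ∀ t, q t = 4 * t ^ 3 - 4 * t ^ 2 - 40 * t - 79) {t : ℝ} (ht : 16 < t) :
    5 < N t / q t := by
  have hqt : 0 < q t := by rw [hq]; exact q_pos_of_five_lt (by linarith)
  rw [lt_div_iff₀ hqt, hN, hq]
  have hs : 0 < t - 16 := sub_pos.2 ht
  have hg : 0 < t ^ 3 - 4 * t ^ 2 - 24 * t - 26 := by
    nlinarith [pow_pos hs 3, pow_pos hs 2, hs]
  nlinarith [mul_pos hs hg]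

/-- `φ > 16` on `{q > 0} ∩ (−∞, 5)`: `N − 16q = (5 − x)(−x³ + 59x² + 211x + 257)`. [folklore] -/
theorem sixteen_lt_phi (hN : ∀ t, N t = t ^ 4 + 20 * t ^ 2 + 158 * t + 21)
    (hq : ∀ t, q t = 4 * t ^ 3 - 4 * t ^ 2 - 40 * t - 79) {t : ℝ} (hqt : 0 < q t) (h5 : t < 5) :
    16 < N t / q t := by
  rw [lt_div_iff₀ hqt, hN, hq]
  rw [hq] at hqt
  have h4 : 4 < t := four_lt_of_q_pos hqt
  have h0 : 0 < t := by linarith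
  have hh : 0 < -t ^ 3 + 59 * t ^ 2 + 211 * t + 257 := by
    nlinarith [mul_pos (pow_pos h0 2) (show (0:ℝ) < 59 - t by linarith)]
  nlinarith [mul_pos (sub_pos.2 h5) hh]

/-- **Onto `(5, ∞)`.** Every `u > 5` is `φ(t)` for some `t > 16` (intermediate value theorem for
`N − u·q` on `[16, 4u + 16]`: negative at `16`, positive at `4u + 16`). [folklore] -/
theorem exists_phi_eq_of_five_lt (hN : ∀ t, N t = t ^ 4 + 20 * t ^ 2 + 158 * t + 21)
    (hq : ∀ t, q t = 4 * t ^ 3 - 4 * t ^ 2 - 40 * t - 79) {u : ℝ} (hu : 5 < u) :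
    ∃ t, 16 < t ∧ N t / q t = u := by
  set p : ℝ → ℝ := fun t => (t ^ 4 + 20 * t ^ 2 + 158 * t + 21)
    - u * (4 * t ^ 3 - 4 * t ^ 2 - 40 * t - 79) with hp
  have hcont : Continuous p := by rw [hp]; fun_prop
  set T : ℝ := 4 * u + 16 with hT
  have h16 : p 16 < 0 := by simp only [hp]; nlinarith
  have hTpos : 0 < T := by rw [hT]; linarith
  have hT' : 0 < p T := by
    have : p T = 16 * T ^ 3 + (4 * u + 20) * T ^ 2 + (40 * u + 158) * T + 79 * u + 21 := by
      simp only [hp, hT]; ring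
    rw [this]; positivity
  obtain ⟨t, ht, hpt⟩ := intermediate_value_Icc (show (16:ℝ) ≤ T by linarith) hcont.continuousOn
    ⟨h16.le, hT'.le⟩
  have ht16 : (16:ℝ) ≠ t := fun h => by rw [← h] at hpt; exact h16.ne hpt
  have ht' : 16 < t := lt_of_le_of_ne ht.1 ht16
  have hqt : 0 < q t := by rw [hq]; exact q_pos_of_five_lt (by linarith)
  refine ⟨t, ht', ?_⟩
  rw [div_eq_iff hqt.ne', hN, hq]
  have : p t = 0 := hpt
  simp only [hp] at this
  linarith

/-- **Onto `(16, ∞)`.** Every `u > 16` is `φ(t)` for some `t < 5` with `q(t) > 0` (intermediate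
value theorem for `N − u·q` on `[4, 5]`: positive at `4`, negative at `5`; at the root,
`u·q(t) = N(t) > 0`). [folklore] -/
theorem exists_phi_eq_of_sixteen_lt (hN : ∀ t, N t = t ^ 4 + 20 * t ^ 2 + 158 * t + 21)
    (hq : ∀ t, q t = 4 * t ^ 3 - 4 * t ^ 2 - 40 * t - 79) {u : ℝ} (hu : 16 < u) :
    ∃ t, 0 < q t ∧ t < 5 ∧ N t / q t = u := by
  set p : ℝ → ℝ := fun t => (t ^ 4 + 20 * t ^ 2 + 158 * t + 21)
    - u * (4 * t ^ 3 - 4 * t ^ 2 - 40 * t - 79) with hp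
  have hcont : Continuous p := by rw [hp]; fun_prop
  have h4 : 0 < p 4 := by simp only [hp]; nlinarith
  have h5 : p 5 < 0 := by simp only [hp]; nlinarith
  obtain ⟨t, ht, hpt⟩ := intermediate_value_Icc' (show (4:ℝ) ≤ 5 by norm_num) hcont.continuousOn
    ⟨h5.le, h4.le⟩
  have ht5 : t ≠ 5 := fun h => by rw [h] at hpt; exact h5.ne hpt
  have ht' : t < 5 := lt_of_le_of_ne ht.2 ht5
  have hpt' : p t = 0 := hpt
  simp only [hp] at hpt'
  have hNt : 0 < t ^ 4 + 20 * t ^ 2 + 158 * t + 21 := N_pos (by linarith [ht.1])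
  have hqt : 0 < q t := by
    rw [hq]
    by_contra hle
    have : u * (4 * t ^ 3 - 4 * t ^ 2 - 40 * t - 79) ≤ 0 :=
      mul_nonpos_of_nonneg_of_nonpos (by linarith) (not_lt.1 hle)
    linarith
  refine ⟨t, hqt, ht', ?_⟩
  rw [div_eq_iff hqt.ne', hN, hq]
  linarith

/-- `φ` is strictly increasing on `(16, ∞)` (`φ′ = W/q² > 0` there). [folklore] -/
theorem strictMonoOn_phi (hN : ∀ t, N t = t ^ 4 + 20 * t ^ 2 + 158 * t + 21)
    (hq : ∀ t, q t = 4 * t ^ 3 - 4 * t ^ 2 - 40 * t - 79) :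
    StrictMonoOn (fun y => N y / q y) (Ioi 16) := by
  set W : ℝ → ℝ := fun t => 4 * t ^ 6 - 8 * t ^ 5 - 200 * t ^ 4 - 1580 * t ^ 3 - 420 * t ^ 2
      - 2992 * t - 11642 with hW
  have hqpos : ∀ t ∈ Ioi (16:ℝ), 0 < q t := fun t ht => by
    rw [hq]; exact q_pos_of_five_lt (lt_trans (by norm_num) ht)
  have hd : ∀ t ∈ Ioi (16:ℝ), HasDerivAt (fun y => N y / q y) (W t / q t ^ 2) t := fun t ht =>
    hasDerivAt_phi hN hq (fun t => by rw [hW]) (hqpos t ht).ne'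
  refine strictMonoOn_of_deriv_pos (convex_Ioi 16)
    (fun t ht => (hd t ht).continuousAt.continuousWithinAt) fun t ht => ?_
  rw [interior_Ioi] at ht
  rw [(hd t ht).deriv]
  exact div_pos (by rw [hW]; exact W_pos ht) (pow_pos (hqpos t ht) 2)

/-- `φ` is strictly decreasing on the interval `{q > 0} ∩ (−∞, 5)` (`φ′ = W/q² < 0` there).
[folklore] -/
theorem strictAntiOn_phi (hN : ∀ t, N t = t ^ 4 + 20 * t ^ 2 + 158 * t + 21)
    (hq : ∀ t, q t = 4 * t ^ 3 - 4 * t ^ 2 - 40 * t - 79) :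
    StrictAntiOn (fun y => N y / q y) {t | 0 < q t ∧ t < 5} := by
  set W : ℝ → ℝ := fun t => 4 * t ^ 6 - 8 * t ^ 5 - 200 * t ^ 4 - 1580 * t ^ 3 - 420 * t ^ 2
      - 2992 * t - 11642 with hW
  have hd : ∀ t ∈ {t | 0 < q t ∧ t < 5}, HasDerivAt (fun y => N y / q y) (W t / q t ^ 2) t :=
    fun t ht => hasDerivAt_phi hN hq (fun t => by rw [hW]) ht.1.ne'
  have hoc : OrdConnected {t | 0 < q t ∧ t < 5} := by
    refine ⟨fun a ha b hb c hc => ⟨?_, hc.2.trans_lt hb.2⟩⟩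
    have := ha.1
    rw [hq] at this ⊢
    exact q_pos_of_le this hc.1
  refine strictAntiOn_of_deriv_neg hoc.convex
    (fun t ht => (hd t ht).continuousAt.continuousWithinAt) fun t ht => ?_
  have ht' := interior_subset ht
  rw [(hd t ht').deriv]
  have hqt := ht'.1
  rw [hq] at hqt
  have h0 : 0 < t := lt_trans (by norm_num) (four_lt_of_q_pos hqt)
  exact div_neg_of_neg_of_pos (by rw [hW]; exact W_neg h0 ht'.2) (pow_pos ht'.1 2)

/-- **`φ((16, ∞)) = (5, ∞)`.** [folklore] -/
theorem image_phi_Ioi (hN : ∀ t, N t = t ^ 4 + 20 * t ^ 2 + 158 * t + 21)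
    (hq : ∀ t, q t = 4 * t ^ 3 - 4 * t ^ 2 - 40 * t - 79) :
    (fun y => N y / q y) '' Ioi 16 = Ioi 5 := by
  ext u
  constructor
  · rintro ⟨t, ht, rfl⟩
    exact five_lt_phi hN hq ht
  · intro hu
    obtain ⟨t, ht, htu⟩ := exists_phi_eq_of_five_lt hN hq hu
    exact ⟨t, ht, htu⟩

/-- **`φ({q > 0} ∩ (−∞, 5)) = (16, ∞)`.** [folklore] -/
theorem image_phi_cell (hN : ∀ t, N t = t ^ 4 + 20 * t ^ 2 + 158 * t + 21)
    (hq : ∀ t, q t = 4 * t ^ 3 - 4 * t ^ 2 - 40 * t - 79) :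
    (fun y => N y / q y) '' {t | 0 < q t ∧ t < 5} = Ioi 16 := by
  ext u
  constructor
  · rintro ⟨t, ht, rfl⟩
    exact sixteen_lt_phi hN hq ht.1 ht.2
  · intro hu
    obtain ⟨t, hqt, ht, htu⟩ := exists_phi_eq_of_sixteen_lt hN hq hu
    exact ⟨t, ⟨hqt, ht⟩, htu⟩

/-- **The Jacobian identity of the duplication move**: where `q(t) > 0` and `q(φ t) > 0`,
`2/√q(t) = (1/√q(φ t))·|φ′(t)|`, from `4·q(φ t) = q(t)·φ′(t)²` (`key_identity`).
[cite: KontsevichZagier2001, §1.2 rule (2)] -/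
theorem jacobian_phi (hN : ∀ t, N t = t ^ 4 + 20 * t ^ 2 + 158 * t + 21)
    (hq : ∀ t, q t = 4 * t ^ 3 - 4 * t ^ 2 - 40 * t - 79)
    (hW : ∀ t, W t = 4 * t ^ 6 - 8 * t ^ 5 - 200 * t ^ 4 - 1580 * t ^ 3 - 420 * t ^ 2
      - 2992 * t - 11642)
    {t : ℝ} (hqt : 0 < q t) (hqφ : 0 < q (N t / q t)) :
    2 / Real.sqrt (q t) = 1 / Real.sqrt (q (N t / q t)) * |W t / q t ^ 2| := by
  have hkey : q (N t / q t) = q t * (W t / q t ^ 2) ^ 2 / 4 := by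
    have hq0 : q t ≠ 0 := hqt.ne'
    have e2 : W t ^ 2 = 4 * (4 * N t ^ 3 - 4 * N t ^ 2 * q t - 40 * N t * q t ^ 2
        - 79 * q t ^ 3) := by
      rw [hW, hN, hq]; exact key_identity t
    rw [hq (N t / q t)]
    field_simp
    rw [e2]
    ring
  have hw : W t / q t ^ 2 ≠ 0 := by
    intro h0
    rw [h0] at hkey
    simp only [ne_eq, OfNat.ofNat_ne_zero, not_false_eq_true, zero_pow, mul_zero, zero_div] at hkey
    exact hqφ.ne' hkey
  have hs : Real.sqrt (q (N t / q t)) = Real.sqrt (q t) * |W t / q t ^ 2| / 2 := by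
    rw [hkey, Real.sqrt_div' _ (by norm_num : (0:ℝ) ≤ 4), Real.sqrt_mul hqt.le,
      Real.sqrt_sq_eq_abs, show Real.sqrt (4:ℝ) = 2 by
        rw [show (4:ℝ) = 2 ^ 2 by norm_num, Real.sqrt_sq (by norm_num)]]
  rw [hs]
  have h1 : 0 < Real.sqrt (q t) := Real.sqrt_pos.mpr hqt
  have h2 : 0 < |W t / q t ^ 2| := abs_pos.mpr hw
  field_simp

end Phi

end Summit.KontsevichZagierPeriods.HeckeMultiplicityOne.TorsionTiling11a1

end
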